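import Literature.Probability.Percolation.IsoradialArmComparisonProofs
import HarnessLib

/-!
# Translation of rhombic embeddings, and the alternating arm events under a change of centre

Bookkeeping companion of `Literature.Probability.LatticeModels.IsoradialGraphs`,
`Literature.Probability.LatticeModels.IsoradialPercolation` and
`Literature.Probability.Percolation.IsoradialArmUniversality`. Grimmett–Manolescu, *Bond
percolation on isoradial graphs: criticality and universality*, PTRF 159 (2014) 273–327 =
arXiv:1204.0505, §3, define the arm events `A_σ^u(N, n)` on the annulus `𝒜^u(N, n) = u + 𝒜(N, n)`
"centred at" an arbitrary vertex `u` of the diamond graph `G^◇`, and state every estimate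
uniformly in `u` (§3: "with limits that are uniform in the choice of `v`"; §8.1 Prop. 8.1:
"for … any vertex `u` of `G^◇`"); the class `𝒢(ε, I)` (BAP(ε) and SGP(I), §4.2) is plainly
invariant under translations of the plane. The tree centres its events at the origin of `ℂ`
(`RhombicEmbedding.embArmEvent`, `RhombicEmbedding.embAltArmEvent`: sup-norm annuli
`{r - 2 ≤ ‖·‖_∞ ≤ R + 2}` around `0`) and vendors Prop. 8.1 for embeddings *with a diamond vertex
at the origin* (`GrimmettManolescu2014_armComparability_one_two`,
`GrimmettManolescu2014_altArmComparability`). This file supplies the elementary passage between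
the two conventions:

* `RhombicEmbedding.translate emb a` — the same rhombic embedding drawn at `z + a`, `c + a`
  (left/right faces unchanged), with its `simp` interface, `translate_zero`,
  `translate_translate`;
* invariance of everything the isoradial files use: `halfAngle_translate`,
  `IsIsoradial.translate`, `HasBoundedAngles.translate`, the combinatorial track data
  (`sides`, `oppositeSide`, `IsTrack`, `IsSimpleTrack` are *equal*, the faces of darts being
  unchanged), hence `squareGridPropertyGM_translate_iff`, `hasSquareGridPropertyGM_translate_iff`
  (printed SGP(I), §4.2) and `hasSquareGridProperty_translate_iff` (H21 rendering);
  `edgeWeight_translate`, `isoradialPercolation_translate` (the canonical measure `P_G` of §1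
  (1.3) depends on the rhombus angles only), `dualOpenGraph_translate`; `rhombus_translate` and
  `IsRhombicTiling.translate` (the rhombic-tiling condition of `Isoradial`);
* **the alternating arm events under a bounded change of centre**
  (`embAltArmEvent_inter_subset_translate`): if `‖a‖_∞ ≤ d` and `r + 2d ≤ R`, then, up to the
  null set of configurations using non-edges of `G`,
  `A_{2j}(r, R)` for `emb` is contained in `A_{2j}(r + d, R - d)` for `emb.translate a` — each
  crossing of the wide annulus around `0` contains a crossing of the narrower annulus around
  `-a` (first-visit / last-exit truncation, one open or dual-open step moving the sup norm by at
  most `2`), and crossings in distinct clusters of the wide annulus are in distinct clusters of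
  the narrow one. In probability: `real_embAltArmEvent_le_translate` and, applied to
  `emb.translate a` and `-a`, `real_translate_embAltArmEvent_le`. This is the sandwich
  `A^u(N - d, n + d) ⊆ A^0(N, n) ⊆ A^u(N + d, n - d)` (`‖u‖_∞ ≤ d`) by which an estimate at one
  centre passes to a nearby centre at the cost of a bounded change of radii — immaterial for
  exponents, and absorbed by Prop. 8.2 (exp_equiv) in the source.

Everything here is proved; no definition of substance and no named fact is introduced (the one
`def` is the translated embedding).

## References

* G. R. Grimmett, I. Manolescu, *Bond percolation on isoradial graphs: criticality and
  universality*, PTRF 159 (2014) 273–327, arXiv:1204.0505: §2.1 (rhombic embeddings, tracks),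
  §3 (annuli `𝒜^u(N, n)`, events `A_σ^u(N, n)` "centred at `u`"), §4.2 (BAP(ε), SGP(I)),
  §8.1 Prop. 8.1 (uniformity in `u`), §8.2 Prop. 8.2 (changes of radii).
-/

noncomputable section

open MeasureTheory
open scoped Pointwise

namespace Literature.Probability.LatticeModels

namespace RhombicEmbedding

variable {V F : Type*} {G : SimpleGraph V}

/-! ### The translated embedding -/

/-- **Translation of a rhombic embedding** by `a ∈ ℂ`: vertices at `z v + a`, face centres at
`c f + a`, the faces left and right of each dart unchanged. It is the same drawing moved by `a`;
`emb.translate (-u)` puts the point `u` (e.g. a vertex `u = z v₀` of the diamond graph) at the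
origin. (Grimmett–Manolescu 2014, §3: the translated annulus `𝒜^u(N, n)` and the events
"centred at `u`".) [cite: GrimmettManolescu2014Isoradial, §3 (events centred at u)] -/
def translate (emb : RhombicEmbedding G F) (a : ℂ) : RhombicEmbedding G F where
  z v := emb.z v + a
  c f := emb.c f + a
  leftFace := emb.leftFace
  rightFace := emb.rightFace

variable (emb : RhombicEmbedding G F) (a b : ℂ)

/-- Vertex positions of the translated embedding. [folklore] -/
@[simp] theorem translate_z (v : V) : (emb.translate a).z v = emb.z v + a := rfl

/-- Face-centre positions of the translated embedding. [folklore] -/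
@[simp] theorem translate_c (f : F) : (emb.translate a).c f = emb.c f + a := rfl

/-- Left faces are unchanged by translation. [folklore] -/
@[simp] theorem translate_leftFace : (emb.translate a).leftFace = emb.leftFace := rfl

/-- Right faces are unchanged by translation. [folklore] -/
@[simp] theorem translate_rightFace : (emb.translate a).rightFace = emb.rightFace := rfl

/-- Translating by `0` does nothing. [folklore] -/
@[simp] theorem translate_zero : emb.translate 0 = emb := by
  cases emb; simp [translate]

/-- Translations compose additively. [folklore] -/
@[simp] theorem translate_translate : (emb.translate a).translate b = emb.translate (a + b) := by
  simp only [translate, mk.injEq, and_true]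
  constructor <;> funext x <;> ring

/-- Translating by `a` and then by `-a` restores the embedding. [folklore] -/
theorem translate_translate_neg : (emb.translate a).translate (-a) = emb := by
  simp

/-- Translating by `-z v₀` puts the vertex `v₀` at the origin. [folklore] -/
theorem translate_z_self (v₀ : V) : (emb.translate (-emb.z v₀)).z v₀ = 0 := by
  simp

/-- Translating by `-c f₀` puts the face centre `f₀` at the origin. [folklore] -/
theorem translate_c_self (f₀ : F) : (emb.translate (-emb.c f₀)).c f₀ = 0 := by
  simp

/-! ### Angles, isoradiality, bounded angles -/

/-- Half-angles are translation invariant (they are read off differences of positions).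
(Grimmett–Manolescu 2014, §2.1.) [folklore] -/
@[simp] theorem halfAngle_translate (d : G.Dart) :
    (emb.translate a).halfAngle d = emb.halfAngle d := by
  simp only [halfAngle, translate_c, translate_z, translate_leftFace, add_sub_add_right_eq_sub]

variable {emb a}

/-- Isoradiality is translation invariant. (Grimmett–Manolescu 2014, §2.1.) [folklore] -/
theorem IsIsoradial.translate (h : emb.IsIsoradial) : (emb.translate a).IsIsoradial where
  norm_sub_eq_one d := by
    simpa only [translate_z, translate_c, translate_leftFace, add_sub_add_right_eq_sub] using
      h.norm_sub_eq_one d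
  leftFace_symm d := by
    simp only [translate_leftFace, translate_rightFace, h.leftFace_symm]
  c_leftFace_ne d := by
    simpa only [translate_c, translate_leftFace, translate_rightFace, ne_eq, add_left_inj] using
      h.c_leftFace_ne d
  z_injective := fun v w hvw => h.z_injective (add_right_cancel hvw)

/-- The bounded-angles property BAP(ε) is translation invariant. (Grimmett–Manolescu 2014,
§4.2.) [folklore] -/
theorem HasBoundedAngles.translate {ε : ℝ} (h : emb.HasBoundedAngles ε) :
    (emb.translate a).HasBoundedAngles ε := fun d => by
  simpa only [halfAngle_translate] using h d

variable (emb a)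

/-! ### Tracks and the square-grid properties: the combinatorial data are unchanged -/

section Tracks

variable [DecidableEq V] [DecidableEq F]

/-- The sides of a dart's rhombus (corner–centre pairs) are unchanged by translation.
[folklore] -/
@[simp] theorem dartSides_translate (d : G.Dart) :
    (emb.translate a).dartSides d = emb.dartSides d := rfl

/-- Opposite sides are unchanged by translation. [folklore] -/
@[simp] theorem dartOppositeSide_translate (d : G.Dart) (p : V × F) :
    (emb.translate a).dartOppositeSide d p = emb.dartOppositeSide d p := rfl

/-- The sides of an edge's rhombus are unchanged by translation. [folklore] -/
@[simp] theorem sides_translate (e : G.edgeSet) : (emb.translate a).sides e = emb.sides e := rfl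

/-- Opposite sides of an edge's rhombus are unchanged by translation. [folklore] -/
@[simp] theorem oppositeSide_translate (e : G.edgeSet) (p : V × F) :
    (emb.translate a).oppositeSide e p = emb.oppositeSide e p := rfl

/-- Tracks are unchanged by translation. (Grimmett–Manolescu 2014, §2.1: tracks are sequences
of rhombi sharing sides — combinatorial data.) [folklore] -/
@[simp] theorem isTrack_translate_iff (r : ℤ → G.edgeSet) :
    (emb.translate a).IsTrack r ↔ emb.IsTrack r := Iff.rfl

/-- Simple tracks are unchanged by translation. [folklore] -/
@[simp] theorem isSimpleTrack_translate_iff (r : ℤ → G.edgeSet) :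
    (emb.translate a).IsSimpleTrack r ↔ emb.IsSimpleTrack r := Iff.rfl

/-- Square grids in the printed sense are unchanged by translation. (Grimmett–Manolescu 2014,
§4.2, SGP(I).) [folklore] -/
theorem isSquareGridGM_translate_iff (s t : ℤ → ℤ → G.edgeSet) (I : ℕ) :
    (emb.translate a).IsSquareGridGM s t I ↔ emb.IsSquareGridGM s t I := by
  constructor <;> intro h <;>
    exact ⟨h.isSimpleTrack_left, h.isSimpleTrack_right, h.pairwise_not_trackMeets_left,
      h.pairwise_not_trackMeets_right, h.not_isReparametrization, h.crossesInOrder_left,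
      h.crossesInOrder_right, h.encard_trackBetween_left_lt, h.encard_trackBetween_right_lt⟩

/-- **SGP(I) is translation invariant.** (Grimmett–Manolescu 2014, §4.2.) [folklore] -/
@[simp] theorem squareGridPropertyGM_translate_iff (I : ℕ) :
    (emb.translate a).SquareGridPropertyGM I ↔ emb.SquareGridPropertyGM I := by
  simp only [SquareGridPropertyGM, isSquareGridGM_translate_iff]

/-- **The printed square-grid property is translation invariant.** (Grimmett–Manolescu 2014,
§4.2.) [folklore] -/
@[simp] theorem hasSquareGridPropertyGM_translate_iff :
    (emb.translate a).HasSquareGridPropertyGM ↔ emb.HasSquareGridPropertyGM := by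
  simp only [HasSquareGridPropertyGM, squareGridPropertyGM_translate_iff]

/-- The H21 rendering of the square-grid property is translation invariant. [folklore] -/
@[simp] theorem hasSquareGridProperty_translate_iff :
    (emb.translate a).HasSquareGridProperty ↔ emb.HasSquareGridProperty := Iff.rfl

end Tracks

/-! ### The canonical measure and the dual open graph are unchanged -/

/-- The canonical edge weights `p_e` (GM (1.3)) are translation invariant. [folklore] -/
@[simp] theorem edgeWeight_translate : (emb.translate a).edgeWeight = emb.edgeWeight := by
  funext e
  unfold edgeWeight
  simp only [halfAngle_translate]

/-- **The canonical percolation measure `P_G` is translation invariant** (it is the product of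
Bernoulli laws with the angle-dependent parameters `p_e`; Grimmett–Manolescu 2014, §1 (1.3)).
[cite: GrimmettManolescu2014Isoradial, §1 (1.3) (P_G determined by the rhombus angles)] -/
@[simp] theorem isoradialPercolation_translate :
    (emb.translate a).isoradialPercolation = emb.isoradialPercolation := by
  simp only [isoradialPercolation, edgeWeight_translate]

/-- The dual open graph of a configuration is unchanged by translation (it is read off the
left/right faces of darts). [folklore] -/
@[simp] theorem dualOpenGraph_translate :
    (emb.translate a).dualOpenGraph = emb.dualOpenGraph := rfl

/-! ### Rhombi and the tiling condition -/

/-- The rhombus of an edge is translated along with the embedding. (Grimmett–Manolescu 2014,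
§2.1, the diamond graph.) [folklore] -/
theorem rhombus_translate (e : G.edgeSet) :
    (emb.translate a).rhombus e = a +ᵥ emb.rhombus e := by
  simp only [rhombus, translate_z, translate_c, translate_leftFace, translate_rightFace,
    ← convexHull_vadd, Set.vadd_set_insert, Set.vadd_set_singleton, vadd_eq_add, add_comm a]

variable {emb a}

/-- **The rhombic-tiling condition is translation invariant**: interiors of translated rhombi
are translated interiors, a translated cover is a cover, and `c + a` is injective with `c`.
(Grimmett–Manolescu 2014, §2.1.) [folklore] -/
theorem IsRhombicTiling.translate (h : emb.IsRhombicTiling) : (emb.translate a).IsRhombicTiling where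
  disjoint_interior e e' hne := by
    show Disjoint (interior ((emb.translate a).rhombus e)) (interior ((emb.translate a).rhombus e'))
    rw [rhombus_translate, rhombus_translate, interior_vadd, interior_vadd, Set.disjoint_vadd_set]
    exact h.disjoint_interior hne
  iUnion_rhombus := by
    simp_rw [rhombus_translate, ← Set.vadd_set_iUnion, h.iUnion_rhombus, Set.vadd_set_univ]
  c_injective := fun f g hfg => h.c_injective (add_right_cancel hfg)

/-- A rhombic tiling has a vertex (the rhombi cover the plane, and each is spanned by an edge).
[folklore] -/
theorem IsRhombicTiling.nonempty (h : emb.IsRhombicTiling) : Nonempty V := by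
  have h0 : (0 : ℂ) ∈ ⋃ e : G.edgeSet, emb.rhombus e := by rw [h.iUnion_rhombus]; trivial
  obtain ⟨e, -⟩ := Set.mem_iUnion.1 h0
  exact ⟨(refDart e).fst⟩

end RhombicEmbedding

end Literature.Probability.LatticeModels

/-! ### The alternating arm events under a bounded change of centre -/

namespace Literature.Probability.Percolation

open LatticeModels Percolation IsoradialArmComparability

/-- The sup norm moves by at most `‖a‖_∞` under translation by `a`: lower bound. [folklore] -/
theorem boxNorm_sub_le_boxNorm_add (w a : ℂ) : w.boxNorm - a.boxNorm ≤ (w + a).boxNorm := by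
  have h := IsoradialCriticality.boxNorm_add_le (w + a) (-a)
  rw [add_neg_cancel_right, IsoradialCriticality.boxNorm_neg] at h
  linarith

/-- **A window of a walk.** Let `f` be a real height on the vertices of a graph `H` moving by at
most `2` along every edge (in both directions), and let `p` be a walk from `u` with `f u ≤ s` to
`v` with `t ≤ f v`, where `s ≤ t`. Then some vertex `u'` of `p` with `f u' ≤ s` is joined, by a
walk `q` all of whose vertices are vertices of `p` with heights in `[s - 2, t + 2]`, to a vertex
`v'` with `t ≤ f v'`: cut `p` at its first visit to `{t ≤ f}`, then restart the initial piece at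
its last visit to `{f ≤ s}` (`exists_walk_truncate` twice). (Last-exit / first-entrance
decomposition; Grimmett–Manolescu 2014, §8.2 and §8.5.2.) [folklore] -/
theorem exists_walk_window {W : Type*} {H : SimpleGraph W} (f : W → ℝ) {s t : ℝ} (hst : s ≤ t)
    (hf : ∀ ⦃a b : W⦄, H.Adj a b → f b ≤ f a + 2) {u v : W} (p : H.Walk u v) (hu : f u ≤ s)
    (hv : t ≤ f v) :
    ∃ (u' v' : W) (q : H.Walk u' v'), u' ∈ p.support ∧ f u' ≤ s ∧ t ≤ f v' ∧
      (∀ y ∈ q.support, y ∈ p.support) ∧ ∀ y ∈ q.support, s - 2 ≤ f y ∧ f y ≤ t + 2 := by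
  -- first visit to `{t ≤ f}`
  obtain ⟨v', q₁, hv', hq₁p, hq₁t⟩ := exists_walk_truncate f t hf p (by linarith) hv
  -- last visit of the initial piece to `{f ≤ s}`: truncate the reversed piece for the height `-f`
  obtain ⟨u', q₂, hu', hq₂q₁, hq₂s⟩ := exists_walk_truncate (fun y => -f y) (-s)
    (fun a b hab => by have := hf hab.symm; linarith) q₁.reverse
    (by have := hq₁t v' q₁.end_mem_support; linarith) (by linarith)
  refine ⟨u', v', q₂.reverse, ?_, by linarith, hv', fun y hy => ?_,
    fun y hy => ?_⟩
  · have h := hq₂q₁ u' q₂.end_mem_support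
    rw [SimpleGraph.Walk.support_reverse, List.mem_reverse] at h
    exact hq₁p u' h
  · rw [SimpleGraph.Walk.support_reverse, List.mem_reverse] at hy
    have h := hq₂q₁ y hy
    rw [SimpleGraph.Walk.support_reverse, List.mem_reverse] at h
    exact hq₁p y h
  · rw [SimpleGraph.Walk.support_reverse, List.mem_reverse] at hy
    have h := hq₂q₁ y hy
    rw [SimpleGraph.Walk.support_reverse, List.mem_reverse] at h
    have h1 := hq₁t y h
    have h2 := hq₂s y hy
    exact ⟨by linarith, h1⟩

section Translate

variable {V F : Type*} {G : SimpleGraph V} (emb : RhombicEmbedding G F)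

/-- The narrow annulus around `-a` lies inside the wide annulus around `0`: if `‖a‖_∞ ≤ d` then
`annulusPts (z + a) (r + d) (R - d) ⊆ annulusPts z r R` (for `d ≤ R`). [folklore] -/
theorem annulusPts_translate_subset {α : Type*} (z : α → ℂ) {a : ℂ} {d : ℕ}
    (ha : a.boxNorm ≤ d) {r R : ℕ} (hdR : d ≤ R) :
    annulusPts (fun x => z x + a) (r + d) (R - d) ⊆ annulusPts z r R := by
  intro x hx
  rw [mem_annulusPts, Set.mem_Icc] at hx ⊢
  have h1 := boxNorm_sub_le_boxNorm_add (z x) a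
  have h2 := IsoradialCriticality.boxNorm_add_le (z x) a
  have hdRℝ : ((R - d : ℕ) : ℝ) = R - d := Nat.cast_sub hdR
  push_cast at hx
  rw [hdRℝ] at hx
  constructor <;> linarith [hx.1, hx.2]

/-- **The alternating arm event under a bounded change of centre** (up to configurations using
non-edges of `G`): if `‖a‖_∞ ≤ d` and `r + 2d ≤ R`, then
`A_{2j}(r, R)[emb] ∩ {ω ⊆ E(G)} ⊆ A_{2j}(r + d, R - d)[emb.translate a]`. Each open crossing
`x_i ↔ y_i` of the annulus `{r - 2 ≤ ‖z‖_∞ ≤ R + 2}` has `‖z x_i + a‖_∞ ≤ r + d` and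
`‖z y_i + a‖_∞ ≥ R - d`, so it contains a window (`exists_walk_window` for the height
`‖z · + a‖_∞`, which moves by at most `2` along open edges of an isoradial graph) crossing the
annulus `{r + d - 2 ≤ ‖z + a‖_∞ ≤ R - d + 2}`, itself contained in the former annulus
(`annulusPts_translate_subset`); the new starting points lie on the old crossings, so two of them
joined inside the narrow annulus would join the old starting points inside the wide one. Dual
crossings likewise (the dual open graph is unchanged, `dualOpenGraph_translate`). This is the
inclusion `A^0(N, n) ⊆ A^u(N + d, n - d)`, `‖u‖_∞ ≤ d`, between events centred at nearby points
(Grimmett–Manolescu 2014, §3, events "centred at `u`"; the change of radii is immaterial by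
§8.2 Prop. 8.2). [cite: GrimmettManolescu2014Isoradial, §3 (A_σ^u(N,n)) and §8.2 Prop. 8.2] -/
theorem _root_.Literature.Probability.LatticeModels.RhombicEmbedding.embAltArmEvent_inter_subset_translate
    (hiso : emb.IsIsoradial) (j : ℕ) {a : ℂ} {d : ℕ} (ha : a.boxNorm ≤ d) {r R : ℕ}
    (hrR : r + 2 * d ≤ R) :
    emb.embAltArmEvent j r R ∩ {ω | ω ⊆ G.edgeSet} ⊆
      (emb.translate a).embAltArmEvent j (r + d) (R - d) := by
  rintro ω ⟨⟨⟨x, y, hxy, hsep⟩, ⟨f, g, hfg, hsep'⟩⟩, hgood⟩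
  have hgood' : ω ⊆ G.edgeSet := hgood
  have hiso' : (emb.translate a).IsIsoradial := hiso.translate
  have hdR : d ≤ R := by omega
  have hdRℝ : ((R - d : ℕ) : ℝ) = R - d := Nat.cast_sub hdR
  have hrdℝ : ((r + d : ℕ) : ℝ) = r + d := by push_cast; ring
  have hst : (r : ℝ) + d ≤ R - d := by
    have : ((r + 2 * d : ℕ) : ℝ) ≤ R := by exact_mod_cast hrR
    push_cast at this; linarith
  have hsub : annulusPts (emb.translate a).z (r + d) (R - d) ⊆ annulusPts emb.z r R :=
    annulusPts_translate_subset emb.z ha hdR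
  have hsubc : annulusPts (emb.translate a).c (r + d) (R - d) ⊆ annulusPts emb.c r R :=
    annulusPts_translate_subset emb.c ha hdR
  refine ⟨?_, ?_⟩
  · -- primal crossings: a window of each, for the height `‖z · + a‖_∞`
    have key : ∀ i, ∃ x' y' : V, ((emb.translate a).z x').boxNorm ≤ ((r + d : ℕ) : ℝ) ∧
        (((R - d : ℕ) : ℕ) : ℝ) ≤ ((emb.translate a).z y').boxNorm ∧
        ω ∈ openConnIn (annulusPts (emb.translate a).z (r + d) (R - d)) x' y' ∧
        ω ∈ openConnIn (annulusPts emb.z r R) (x i) x' := by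
      intro i
      obtain ⟨hx, hy, hconn⟩ := hxy i
      obtain ⟨w, hw⟩ := mem_openConnIn_iff_exists_openWalk.1 hconn
      have hu : ((emb.translate a).z (x i)).boxNorm ≤ r + d := by
        have := IsoradialCriticality.boxNorm_add_le (emb.z (x i)) a
        simp only [RhombicEmbedding.translate_z]; linarith
      have hv : (R : ℝ) - d ≤ ((emb.translate a).z (y i)).boxNorm := by
        have := boxNorm_sub_le_boxNorm_add (emb.z (y i)) a
        simp only [RhombicEmbedding.translate_z]; linarith
      obtain ⟨x', y', q, hx'w, hx', hy', hqw, hqf⟩ := exists_walk_window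
        (fun v => ((emb.translate a).z v).boxNorm) hst
        (fun u v huv => (emb.translate a).boxNorm_z_le_of_openGraph_adj hiso' hgood' huv) w hu hv
      refine ⟨x', y', by rw [hrdℝ]; exact hx', by rw [hdRℝ]; exact hy',
        mem_openConnIn_iff_exists_openWalk.2 ⟨q, fun v hv => ?_⟩,
        mem_openConnIn_of_mem_support_openWalk w hw hx'w⟩
      rw [mem_annulusPts, Set.mem_Icc, hrdℝ, hdRℝ]
      exact hqf v hv
    choose x' y' hx'r hy'R hconn' hxx' using key
    refine ⟨x', y', fun i => ⟨hx'r i, hy'R i, hconn' i⟩, fun i i' hii' hc => hsep hii' ?_⟩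
    -- `x_i ↔ x_i' ↔ x_{i'}' ↔ x_{i'}` inside the wide annulus
    exact PlanarDuality.openConnIn_trans
      (PlanarDuality.openConnIn_trans (hxx' i) (openConnIn_mono hsub _ _ hc))
      ((openConnIn_comm _ _ _).subset (hxx' i'))
  · -- dual crossings, likewise, in the (unchanged) dual open graph
    have key : ∀ i, ∃ f' g' : F, ((emb.translate a).c f').boxNorm ≤ ((r + d : ℕ) : ℝ) ∧
        (((R - d : ℕ) : ℕ) : ℝ) ≤ ((emb.translate a).c g').boxNorm ∧
        (emb.translate a).dualConnIn ω (annulusPts (emb.translate a).c (r + d) (R - d)) f' g' ∧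
        emb.dualConnIn ω (annulusPts emb.c r R) (f i) f' := by
      intro i
      obtain ⟨hf, hg, hconn⟩ := hfg i
      obtain ⟨w, hw⟩ := (emb.dualConnIn_iff_exists_walk ω _ _ _).1 hconn
      have hu : ((emb.translate a).c (f i)).boxNorm ≤ r + d := by
        have := IsoradialCriticality.boxNorm_add_le (emb.c (f i)) a
        simp only [RhombicEmbedding.translate_c]; linarith
      have hv : (R : ℝ) - d ≤ ((emb.translate a).c (g i)).boxNorm := by
        have := boxNorm_sub_le_boxNorm_add (emb.c (g i)) a
        simp only [RhombicEmbedding.translate_c]; linarith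
      obtain ⟨f', g', q, hf'w, hf', hg', hqw, hqf⟩ := exists_walk_window
        (fun v => ((emb.translate a).c v).boxNorm) hst
        (fun u v huv => (emb.translate a).boxNorm_c_le_of_dualOpenGraph_adj hiso'
          (by rw [RhombicEmbedding.dualOpenGraph_translate]; exact huv)) w hu hv
      refine ⟨f', g', by rw [hrdℝ]; exact hf', by rw [hdRℝ]; exact hg',
        ((emb.translate a).dualConnIn_iff_exists_walk ω _ _ _).2 ⟨?_, ?_⟩,
        emb.dualConnIn_of_mem_support w hw hf'w⟩
      · rw [RhombicEmbedding.dualOpenGraph_translate]; exact q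
      · intro v hv
        rw [mem_annulusPts, Set.mem_Icc, hrdℝ, hdRℝ]
        exact hqf v hv
    choose f' g' hf'r hg'R hconn' hff' using key
    refine ⟨f', g', fun i => ⟨hf'r i, hg'R i, hconn' i⟩, fun i i' hii' hc => hsep' hii' ?_⟩
    have hc' : emb.dualConnIn ω (annulusPts (emb.translate a).c (r + d) (R - d)) (f' i) (f' i') :=
      hc
    exact emb.dualConnIn_trans (emb.dualConnIn_trans (hff' i) (emb.dualConnIn_mono hsubc hc'))
      (emb.dualConnIn_symm (hff' i'))

/-- **In probability: moving the centre by `‖a‖_∞ ≤ d` costs a change of radii by `d`.**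
`P_G[A_{2j}(r, R), centre 0] ≤ P_G[A_{2j}(r + d, R - d), centre -a]` for `r + 2d ≤ R` (the
canonical measure is the same for `emb` and `emb.translate a`, `isoradialPercolation_translate`).
[cite: GrimmettManolescu2014Isoradial, §3 (A_σ^u(N,n)); §8.1 Prop. 8.1 (uniform in u)] -/
theorem _root_.Literature.Probability.LatticeModels.RhombicEmbedding.real_embAltArmEvent_le_translate
    [Countable V] (hiso : emb.IsIsoradial) (j : ℕ) {a : ℂ} {d : ℕ} (ha : a.boxNorm ≤ d)
    {r R : ℕ} (hrR : r + 2 * d ≤ R) :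
    emb.isoradialPercolation.real (emb.embAltArmEvent j r R) ≤
      emb.isoradialPercolation.real ((emb.translate a).embAltArmEvent j (r + d) (R - d)) :=
  emb.real_le_real_of_inter_subset (emb.embAltArmEvent_inter_subset_translate hiso j ha hrR)

/-- **The converse sandwich**: `P_G[A_{2j}(r, R), centre -a] ≤ P_G[A_{2j}(r + d, R - d), centre 0]`
for `‖a‖_∞ ≤ d`, `r + 2d ≤ R` (the previous inequality for `emb.translate a` and `-a`).
[cite: GrimmettManolescu2014Isoradial, §3 (A_σ^u(N,n)); §8.1 Prop. 8.1 (uniform in u)] -/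
theorem _root_.Literature.Probability.LatticeModels.RhombicEmbedding.real_translate_embAltArmEvent_le
    [Countable V] (hiso : emb.IsIsoradial) (j : ℕ) {a : ℂ} {d : ℕ} (ha : a.boxNorm ≤ d)
    {r R : ℕ} (hrR : r + 2 * d ≤ R) :
    emb.isoradialPercolation.real ((emb.translate a).embAltArmEvent j r R) ≤
      emb.isoradialPercolation.real (emb.embAltArmEvent j (r + d) (R - d)) := by
  have ha' : (-a).boxNorm ≤ d := by rwa [IsoradialCriticality.boxNorm_neg]
  have h := (emb.translate a).real_embAltArmEvent_le_translate hiso.translate j ha' hrR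
  rwa [RhombicEmbedding.translate_translate_neg, RhombicEmbedding.isoradialPercolation_translate]
    at h

end Translate

end Literature.Probability.Percolation

end
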